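import Literature.MathematicalPhysics.QuantumFieldTheory.Balaban1983to89.B9Thm311SmallFieldCoercivity
import Literature.MathematicalPhysics.QuantumFieldTheory.Balaban1983to89.B5Eq190FlatCoercivityUniform

/-!
# `Balaban1983to89.B9Thm311SmallFieldCoercivityUniform` — T. Bałaban, *Propagators for lattice gauge theories in a background field*, Commun. Math.
# Phys. **99** (1985) 389–434 [Balaban1985BackgroundPropagators] Thm 3.11 p. 416 with (3.82)–(3.86) p. 407, and *Propagators and renormalization
# transformations for lattice gauge theories. I* [Balaban1984PropagatorsI] Prop. 1.1 (1.90) p. 33: THE SECOND HALF OF THM 3.11 FOR THE pub-balaban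
# NE9 CHAIN'S PRINCIPAL GAUGE-FIXED OPERATOR WITH `γ, ε₀` CHOSEN BEFORE THE VOLUME — `∃ γ ε₀ > 0, ∀ m, ∀ U small, γ‖x‖² ≤ re⟨x, Δ_prin(U)x⟩`

statement-level skeleton of published theorems with citation tags; proofs where landed; nothing here is a claim about the Yang–Mills mass gap

PDF held: `paper:balaban1985-cmp99-background-propagators` pp. 406–407, 416 via the OWNER's `B9Thm311SmallFieldCoercivity` docstrings (quoted there
verbatim, re-read by this seat in the tree); `paper:balaban1984-cmp95-propagators-rt-i` p. 33 read first-hand (2026-08-22, text layer p0017).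

THE PRINT (verbatim).  [B9] p. 416: *«Theorem 3.11. Under the assumptions of the Theorems 3.1–3.10 (i.e. for M sufficiently large and α₀
sufficiently small) the operators Δ′_a, G′, (Q′G′²Q′*)⁻¹, Δ_a, G are positive definite. … by (3.86) we get G_□(e^{iηA}) = G_□(1)(I − V(A)G_□(1))⁻¹.
In [4] we have proved that the operator G_□(1) is positive»*; [B5] p. 33: *«with a positive constant γ₀ independent of k, T_η, and depending on d
only (if we put a = 1). This implies the bound from below: Δ_a = G⁻¹ ≥ γ₀(Δ + I). (1.90)»*.

WHY THIS FILE (cell context).  The OWNER's (C2) `B9Thm311SmallFieldCoercivity.exists_coercive_principal_of_small_field` (p314868) proves Thm 3.11's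
second half AT A FIXED LATTICE: its `∃ γ ε₀` stands AFTER the volume `m`, because three of its inputs were finite-lattice numbers — the flat constant
`γ₀` (compactness), the operator norm `M_Q` of `Q(1)` (an unnamed `‖·‖`), and the sup-to-`L²` factor `C_S = L^d√(c₀·#sites)` converting the
sup-currency `Q′`-closeness into §5's centre-lift slot `hρ` — (the flat modulus `μ` was already leaf-04's explicit `2∕(L²η²)`).  The NE9 leaves'
letters since then are volume-free for each: `γ₀` = [B5] (1.90) transported (`B5Eq190FlatCoercivityUniform`, this lineage gen 59), `M_Q` =
`M_φ′M_φ√(c₁∕(c₀L^d))` (`B9Eq315QFlatNorm`, gen 58), and the `Q′`-closeness READ in the centre-lift currency (`B9Eq319CentreLiftL2`, gen 58 — the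
hypothesis here IS §5's `hρ` slot, `C_S := 1`).  This file re-runs the owner's §6 with these three inputs and moves `∃ γ ε₀` in front of `∀ m`
(the NE9 pricing desk's pre-declared reading, PRICING-NE9 v32∕v34 §D: «(C2) RESTATED with the volume quantified INSIDE»).

WHAT IS PROVED (sorry-free; 0 `def`; no inequality of the papers asserted — (1.90) enters as the tree theorem `B5DeltaA169.smul_LapOne_le_DeltaA`).
* §7 **`exists_coercive_principal_of_small_field_uniform`**: `∃ γ ε₀ > 0, ∀ m, ∀ U` (E162 data; `U(b) ∈ U1`, `‖U(b) − 1‖ ≤ ε`, `hRS`; centre-lift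
  `Q′`-closeness `ρ`; `‖Q(U)x − Q(1)x‖ ≤ δ_Q‖x‖`; `ε + ρ + δ_Q ≤ ε₀`): `γ‖x‖² ≤ re⟨x, (D*D + DR(U)D* + aQ(U)*Q(U))x⟩` — the OWNER's §6 argument
  VERBATIM (constants `K_R = 2M_φM_φ′`, `B`, `K`, `ε₀ = min(1∕(K_R+1), μ∕(2B+1), γ₀∕(2K+1))`, `γ = γ₀∕2`) on §5's `norm_principalGF_sub_flat_le`,
  closed by `B5Eq190FlatCoercivityUniform.coercive_principal_of_near_flat_uniform` instead of `B5Eq172FlatCoercivity.exists_coercive_principal_of_near_flat`.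
MODEL / DECLARED READINGS.  (M1) as the owner's (C2): the chain's encodings, one averaging step, fine weight `c₀`, coarse weight `c₁`, fibre reading
`φ` with bounds `M_φ`, `M_φ′`.  (M2) DISPLAYED (hypotheses, as there): `hRS`, the two averaging closeness letters (now in Hilbert ∕ centre-lift
currency; discharged per `U` in `B9Thm311SmallFieldClosedUniform`), `U(b) ∈ U1`, `‖U(b) − 1‖ ≤ ε`.  (M3) NOT HERE: print's uniformity in the SPACING
((3.85)–(3.86) through Thm 3.3's decay — `γ, ε₀` here depend on `L`, `η`), the gauge step of p. 416, the curvature part (sequel file), analyticity,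
the multi-level operators.
HONEST SCOPE.  [folklore] finite-dimensional perturbation bookkeeping — the OWNER's mechanism re-run with volume-free letters; ONE quantifier moved;
nothing of [B9] asserted; «NE9 ⇐ the named binders»; NE9 NOT PRINTED ∕ NOT PROVED; NOT summit progress (cell pub-balaban: spine PROVED 0/9; rung (B)+1
finite T⁴ — NOT infinite volume, NOT mass gap, NOT Clay; HONEST DEPENDENCY: continuum YM on T⁴ ⇐ BetaPertH ∧ nine spine estimates (0/9 proved); BetaPertH
⇐ (D1) ∧ (D4) ∧ CAP+tail; G-an2-4 gates asym, D1 and NE2/3/4).  Unit `b2b-balaban-t4-ne9-formalise-leaf-03` (NE9 crux-team leaf prover, gen 59), INTENT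
I-ne9leaf03-g59-2 item (C2′), filed after the OWNER `b2b-balaban-t4-ne9-p1`'s first refusal; NEW file importing `B9Thm311SmallFieldCoercivity` +
`B5Eq190FlatCoercivityUniform`; modifies nothing (the owner's per-lattice (C2) stays as landed).  Net new unproved facts: 0.
-/

noncomputable section

open scoped InnerProductSpace ComplexConjugate BigOperators

namespace Literature.MathematicalPhysics.QuantumFieldTheory.Balaban1983to89.B9Thm311SmallFieldCoercivityUniform

open B4Sect5Torus (TSite)
open B9SectCLatticeCarrier (Bond)
open B7Prop1Explicit (U1 Wcx boxVec)
open B9Eq311L2Pairing (WL2)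
open B9Eq319QprimeTorus (fineP centre weight)
open B9Eq319Onto (centreFun)
open B11Eq103H1Complex (SiteL2K BondL2K covLaplaceSiteK laplaceALatticeK)
open B9Eq310HessianOperator (adTransportW principalOpK)
open B9Eq326OperatorAssembly (RofU QprimeW)
open B9Eq315QTorus (perCfg cornerSite QtorusW)
open B5Eq172FlatCoercivity (hU1_one hreg_one)
open B9Eq384RemainderLetters (norm_adTransportW_sub_le)
open B9Eq323FlatBlockPoincare (flat_modulus_explicit)
open B9Eq315QFlatNorm (norm_QtorusW_one_le)
open B9Thm311SmallFieldCoercivity (norm_principalGF_sub_flat_le)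
open B5Eq190FlatCoercivityUniform (flatConst_pos coercive_principal_of_near_flat_uniform)

/-! ## §7 [B9] Thm 3.11's second half with `∃ γ ε₀ > 0` BEFORE the volume -/

section Uniform

variable {d : ℕ} (L : ℕ) [NeZero L] (hL : 1 ≤ L)
  {𝔸 : Type*} [NormedRing 𝔸] [NormedAlgebra ℂ 𝔸] [CompleteSpace 𝔸] [NormOneClass 𝔸]
  {W : Type*} [NormedAddCommGroup W] [InnerProductSpace ℂ W] [FiniteDimensional ℂ W] (φ : W ≃ₗ[ℂ] 𝔸) {c₀ c₁ : ℝ} [Fact (0 < c₀)] [Fact (0 < c₁)]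

/-- arithmetic helper: `t ≤ μ/(2B+1)` gives `B·t ≤ μ/2` (as in `B9Thm311SmallFieldCoercivity`). [folklore] -/
private theorem mul_le_half_of_le_div {B μ t : ℝ} (hB : 0 ≤ B) (hμ : 0 ≤ μ) (ht : t ≤ μ / (2 * B + 1)) : B * t ≤ μ / 2 := by
  have h1 : B * t ≤ B * (μ / (2 * B + 1)) := mul_le_mul_of_nonneg_left ht hB
  have h2 : B * (μ / (2 * B + 1)) ≤ μ / 2 := by
    rw [mul_div_assoc', div_le_div_iff₀ (by positivity) (by norm_num)]
    nlinarith
  exact h1.trans h2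
set_option maxHeartbeats 400000 in
/-- **[B9] THM 3.11, SECOND HALF, WITH `γ, ε₀` INDEPENDENT OF THE VOLUME**: the OWNER's `B9Thm311SmallFieldCoercivity.exists_coercive_principal_
of_small_field` (`∃ γ ε₀ > 0` per lattice) RESTATED with the volume `m` quantified INSIDE — ONE pair `(γ, ε₀)` of numbers depending on
`d, L, η, a, c₀, c₁, M_φ, M_φ′` ONLY such that on EVERY periodic lattice `TSite d (L·m)` and for EVERY background `U` of E162's data with
unit-bounded, `ε`-small bond variables, mutually adjoint transporters (`hRS`), and averaging operators close to the flat ones in HILBERT currency —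
the centre lift of `Q′(U)λ − Q′(1)λ` bounded by `ρ‖λ‖` (the `hρ` slot of §5, as discharged volume-free by `B9Eq319CentreLiftL2`) and
`‖Q(U)x − Q(1)x‖ ≤ δ_Q‖x‖` (`B9Eq383QSemiLocal`) — with `ε + ρ + δ_Q ≤ ε₀`: `γ‖x‖² ≤ re⟨x, (D*D + DR(U)D* + aQ(U)*Q(U))x⟩`.  The proof is
the owner's §6 VERBATIM with its three volume-dependent inputs replaced by volume-free tree letters: the flat constant `γ₀` by
`B5Eq190FlatCoercivityUniform.coercive_principal_of_near_flat_uniform` ([B5] (1.90)), the flat modulus `μ := 2∕(L²η²)` by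
`B9Eq323FlatBlockPoincare.flat_modulus_explicit`, the bound `M_Q := M_φ′M_φ√(c₁∕(c₀L^d))` of `Q(1)` by `B9Eq315QFlatNorm.norm_QtorusW_one_le`,
and the sup-to-`L²` factor `C_S` by `1` (the `Q′`-closeness is taken in the centre-lift currency).  Print's own uniformity ((3.85)–(3.86) through
Thm 3.3's DECAY, uniform in the spacing as well) is NOT this: here the constants are uniform in the VOLUME at fixed `L`, `η`.
[cite: Balaban1985BackgroundPropagators, Thm 3.11 p.416, (3.82)–(3.86) p.407; Balaban1984PropagatorsI, Prop. 1.1 (1.90) p.33, (1.72) p.30] -/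
theorem exists_coercive_principal_of_small_field_uniform {η : ℝ} (hη : η ≠ 0) {a : ℝ} (ha : 0 < a) {Mφ Mφ' : ℝ} (hMφ : 0 ≤ Mφ)
    (hMφ' : 0 ≤ Mφ') (hφ : ∀ w, ‖φ w‖ ≤ Mφ * ‖w‖) (hφ' : ∀ X, ‖φ.symm X‖ ≤ Mφ' * ‖X‖) :
    ∃ γ ε₀ : ℝ, 0 < γ ∧ 0 < ε₀ ∧ ∀ (m : Fin d → ℕ) [∀ i, NeZero (fineP L m i)]
      (U : Bond d (fineP L m) → 𝔸ˣ) {α : ℝ} (hα1 : α ≤ 1 / 64)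
      (hU1 : ∀ (x : B7Prop1Explicit.Site d) (κ : Fin d), perCfg (fineP L m) U x κ ∈ U1 𝔸)
      (hreg : ∀ (y : TSite d m) (κ : Fin d) (r : Fin d → Fin L), ‖((Wcx L (perCfg (fineP L m) U) (cornerSite L y) κ (boxVec L r) : 𝔸ˣ) : 𝔸) - 1‖ ≤ α)
      {ε ρ' δQ : ℝ}, 0 ≤ ε → 0 ≤ ρ' → 0 ≤ δQ → ε + ρ' + δQ ≤ ε₀ →
      (∀ b, U b ∈ U1 𝔸) → (∀ b, ‖(U b : 𝔸) - 1‖ ≤ ε) →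
      (∀ (b : Bond d (fineP L m)) (v u : W), ⟪adTransportW φ U b v, u⟫_ℂ = ⟪v, adTransportW φ (fun b => (U b)⁻¹) b u⟫_ℂ) →
      (∀ l : SiteL2K ℂ d (fineP L m) c₀ W,
        ‖(WL2.equiv ℂ (fun _ : TSite d (fineP L m) => c₀) W).symm (centreFun (weight L m) (centre L m)
          (QprimeW L m φ U l - QprimeW L m φ (fun _ : Bond d (fineP L m) => (1 : 𝔸ˣ)) l))‖ ≤ ρ' * ‖l‖) →
      (∀ x : BondL2K ℂ d (fineP L m) c₀ W, ‖QtorusW L m hL φ U hα1 hU1 hreg (c₁ := c₁) x -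
        QtorusW L m hL φ (fun _ => 1) (show (0 : ℝ) ≤ 1 / 64 by norm_num) (hU1_one L m) (hreg_one L m) (c₁ := c₁) x‖ ≤ δQ * ‖x‖) →
      ∀ x : BondL2K ℂ d (fineP L m) c₀ W, γ * ‖x‖ ^ 2 ≤
        RCLike.re ⟪x, laplaceALatticeK ((η : ℂ))⁻¹ (adTransportW φ U) (adTransportW φ fun b => (U b)⁻¹) (principalOpK φ η U) (RofU L m φ η U)
          (QtorusW L m hL φ U hα1 hU1 hreg (c₁ := c₁)) a x⟫_ℂ := by
  have hc₀ : 0 < c₀ := Fact.out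
  have hc₁ : 0 < c₁ := Fact.out
  have hL0 : (0 : ℝ) < L := by exact_mod_cast Nat.pos_of_ne_zero (NeZero.ne L)
  -- the flat constants, ALL volume-free: `γ₀` ([B5] (1.90) transported), `μ = 2/(L²η²)`, `MQ = M_φ′M_φ√(c₁/(c₀L^d))`
  obtain ⟨γ₀, hγ₀def⟩ : ∃ γ₀ : ℝ,
      γ₀ = (1 / ((d + 1 : ℝ) * B5Prop11Plancherel.Cst d (a * c₁ * (η * L) ^ 2 / (c₀ * (L : ℝ) ^ d)))) * ((η * L)⁻¹) ^ 2 := ⟨_, rfl⟩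
  have hγ₀ : 0 < γ₀ := by rw [hγ₀def]; exact flatConst_pos L (d := d) (c₀ := c₀) (c₁ := c₁) (a := a) hη
  obtain ⟨μ, hμdef⟩ : ∃ μ : ℝ, μ = 2 / ((L : ℝ) ^ 2 * η ^ 2) := ⟨_, rfl⟩
  have hμ : 0 < μ := by rw [hμdef]; positivity
  obtain ⟨MQ, hMQdef⟩ : ∃ MQ : ℝ, MQ = Mφ' * Mφ * Real.sqrt (c₁ / (c₀ * (L : ℝ) ^ d)) := ⟨_, rfl⟩
  have hMQ : 0 ≤ MQ := by rw [hMQdef]; positivity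
  -- the lattice constants (the owner's, with the sup-to-`L²` factor `C_S := 1`: the `Q′`-closeness is in the centre-lift currency)
  have hnc : 0 ≤ ‖((η : ℂ))⁻¹‖ := norm_nonneg _
  obtain ⟨KR, hKRdef⟩ : ∃ KR : ℝ, KR = 2 * Mφ * Mφ' := ⟨_, rfl⟩
  have hKR : 0 ≤ KR := by rw [hKRdef]; positivity
  obtain ⟨CS, hCSdef⟩ : ∃ CS : ℝ, CS = 1 := ⟨_, rfl⟩
  have hCS : 0 ≤ CS := by rw [hCSdef]; positivity
  obtain ⟨B, hBdef⟩ : ∃ B : ℝ, B = μ * CS + 6 * ‖((η : ℂ))⁻¹‖ ^ 2 * d * KR + 16 * ‖((η : ℂ))⁻¹‖ ^ 2 * d * CS := ⟨_, rfl⟩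
  have hB : 0 ≤ B := by rw [hBdef]; positivity
  obtain ⟨K, hKdef⟩ : ∃ K : ℝ, K = 48 * d * ‖((η : ℂ))⁻¹‖ ^ 2 * KR + 8 * ‖((η : ℂ))⁻¹‖ ^ 2 * d * KR + 64 * ‖((η : ℂ))⁻¹‖ ^ 2 * d * (6 * ‖((η : ℂ))⁻¹‖ ^ 2 * d * KR + 16 * ‖((η : ℂ))⁻¹‖ ^ 2 * d * CS) / μ
    + |a| * (2 * MQ + 1) := ⟨_, rfl⟩
  have hK : 0 ≤ K := by rw [hKdef]; positivity
  refine ⟨γ₀ / 2, min (1 / (KR + 1)) (min (μ / (2 * B + 1)) (γ₀ / (2 * K + 1))), by positivity, by positivity, ?_⟩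
  intro m _ U α hα1 hU1 hreg ε ρ' δQ hε hρ' hδQ ht hUb hUε hRS hQ' hQ x
  -- the per-lattice letters at these constants
  have hmod : ∀ l : SiteL2K ℂ d (fineP L m) c₀ W, QprimeW L m φ (fun _ : Bond d (fineP L m) => (1 : 𝔸ˣ)) l = 0 →
      μ * ‖l‖ ≤ ‖covLaplaceSiteK ((η : ℂ))⁻¹ (adTransportW φ (fun _ : Bond d (fineP L m) => (1 : 𝔸ˣ)))
        (adTransportW φ fun _ : Bond d (fineP L m) => (1 : 𝔸ˣ)⁻¹) l‖ := fun l hl => by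
    rw [hμdef]; exact flat_modulus_explicit L m φ hη l hl
  have hQ₁ : ∀ x : BondL2K ℂ d (fineP L m) c₀ W,
      ‖QtorusW L m hL φ (fun _ => 1) (show (0 : ℝ) ≤ 1 / 64 by norm_num) (hU1_one L m) (hreg_one L m) (c₀ := c₀) (c₁ := c₁) x‖ ≤ MQ * ‖x‖ :=
    fun x => by
      rw [hMQdef]
      exact norm_QtorusW_one_le L m hL (show (0 : ℝ) ≤ 1 / 64 by norm_num) (hU1_one L m) (hreg_one L m) φ hMφ hφ hMφ' hφ' x
  -- `t = ε + ρ′ + δ_Q` and its three consequences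
  have ht1 : ε + ρ' + δQ ≤ 1 / (KR + 1) := ht.trans (min_le_left _ _)
  have ht2 : ε + ρ' + δQ ≤ μ / (2 * B + 1) := ht.trans ((min_le_right _ _).trans (min_le_left _ _))
  have ht3 : ε + ρ' + δQ ≤ γ₀ / (2 * K + 1) := ht.trans ((min_le_right _ _).trans (min_le_right _ _))
  have hεt : ε ≤ ε + ρ' + δQ := by linarith
  have hρt : ρ' ≤ ε + ρ' + δQ := by linarith
  have hδQt : δQ ≤ ε + ρ' + δQ := by linarith
  have ht01 : ε + ρ' + δQ ≤ 1 := ht1.trans (by rw [div_le_one (by positivity)]; linarith)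
  have hδQ1 : δQ ≤ 1 := hδQt.trans ht01
  -- the letters of `coercive_of_remainder_le`
  obtain ⟨εR, hεRdef⟩ : ∃ εR : ℝ, εR = KR * ε := ⟨_, rfl⟩
  have hεR : 0 ≤ εR := by rw [hεRdef]; positivity
  have hεRt : εR ≤ KR * (ε + ρ' + δQ) := by rw [hεRdef]; exact mul_le_mul_of_nonneg_left hεt hKR
  have hεR1 : εR ≤ 1 := by
    refine hεRt.trans ((mul_le_mul_of_nonneg_left ht1 hKR).trans ?_)
    rw [mul_one_div, div_le_one (by positivity)]; linarith
  have hR : ∀ (b : Bond d (fineP L m)) (w : W), ‖adTransportW φ U b w - w‖ ≤ εR * ‖w‖ := fun b w => by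
    have h := norm_adTransportW_sub_le φ hφ hφ' hMφ' U b (hUb b) (hUε b) w
    rw [hεRdef, hKRdef]; linarith
  obtain ⟨ρ, hρdef⟩ : ∃ ρ : ℝ, ρ = CS * ρ' := ⟨_, rfl⟩
  have hρ0 : 0 ≤ ρ := by rw [hρdef]; positivity
  have hρ : ∀ l : SiteL2K ℂ d (fineP L m) c₀ W,
      ‖(WL2.equiv ℂ (fun _ : TSite d (fineP L m) => c₀) W).symm (centreFun (weight L m) (centre L m)
        (QprimeW L m φ U l - QprimeW L m φ (fun _ : Bond d (fineP L m) => (1 : 𝔸ˣ)) l))‖ ≤ ρ * ‖l‖ := fun l => by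
    rw [hρdef, hCSdef, one_mul]; exact hQ' l
  have hρt : ρ ≤ CS * (ε + ρ' + δQ) := by rw [hρdef]; exact mul_le_mul_of_nonneg_left hρt hCS
  -- the smallness bookkeeping: `εΔ + Mρ + μρ ≤ B·t ≤ μ/2`
  have hd0 : (0 : ℝ) ≤ d := Nat.cast_nonneg d
  have hsd : Real.sqrt d * Real.sqrt d = d := Real.mul_self_sqrt hd0
  have hεΔ : 2 * (2 + εR) * ‖((η : ℂ))⁻¹‖ ^ 2 * d * εR ≤ 6 * ‖((η : ℂ))⁻¹‖ ^ 2 * d * KR * (ε + ρ' + δQ) := by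
    have h1 : 2 * (2 + εR) ≤ 6 := by linarith
    calc 2 * (2 + εR) * ‖((η : ℂ))⁻¹‖ ^ 2 * d * εR = (2 * (2 + εR)) * (‖((η : ℂ))⁻¹‖ ^ 2 * d * εR) := by ring
      _ ≤ 6 * (‖((η : ℂ))⁻¹‖ ^ 2 * d * (KR * (ε + ρ' + δQ))) :=
          mul_le_mul h1 (mul_le_mul_of_nonneg_left hεRt (by positivity)) (by positivity) (by norm_num)
      _ = 6 * ‖((η : ℂ))⁻¹‖ ^ 2 * d * KR * (ε + ρ' + δQ) := by ring
  have hM16 : 4 * (1 + εR) ^ 2 * ‖((η : ℂ))⁻¹‖ ^ 2 * d ≤ 16 * ‖((η : ℂ))⁻¹‖ ^ 2 * d := by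
    have h1 : (1 + εR) ^ 2 ≤ 4 := by
      calc (1 + εR) ^ 2 ≤ 2 ^ 2 := pow_le_pow_left₀ (by positivity) (by linarith) 2
        _ = 4 := by norm_num
    calc 4 * (1 + εR) ^ 2 * ‖((η : ℂ))⁻¹‖ ^ 2 * d = (1 + εR) ^ 2 * (4 * ‖((η : ℂ))⁻¹‖ ^ 2 * d) := by ring
      _ ≤ 4 * (4 * ‖((η : ℂ))⁻¹‖ ^ 2 * d) := mul_le_mul_of_nonneg_right h1 (by positivity)
      _ = 16 * ‖((η : ℂ))⁻¹‖ ^ 2 * d := by ring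
  have hMρ : 4 * (1 + εR) ^ 2 * ‖((η : ℂ))⁻¹‖ ^ 2 * d * ρ ≤ 16 * ‖((η : ℂ))⁻¹‖ ^ 2 * d * CS * (ε + ρ' + δQ) :=
    calc 4 * (1 + εR) ^ 2 * ‖((η : ℂ))⁻¹‖ ^ 2 * d * ρ ≤ 16 * ‖((η : ℂ))⁻¹‖ ^ 2 * d * ρ := mul_le_mul_of_nonneg_right hM16 hρ0
      _ ≤ 16 * ‖((η : ℂ))⁻¹‖ ^ 2 * d * (CS * (ε + ρ' + δQ)) := mul_le_mul_of_nonneg_left hρt (by positivity)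
      _ = 16 * ‖((η : ℂ))⁻¹‖ ^ 2 * d * CS * (ε + ρ' + δQ) := by ring
  have hμρ : μ * ρ ≤ μ * CS * (ε + ρ' + δQ) := by
    rw [mul_assoc]; exact mul_le_mul_of_nonneg_left hρt hμ.le
  have hBt : B * (ε + ρ' + δQ) ≤ μ / 2 := mul_le_half_of_le_div hB hμ.le ht2
  have hsum : μ * ρ + (2 * (2 + εR) * ‖((η : ℂ))⁻¹‖ ^ 2 * d * εR + 4 * (1 + εR) ^ 2 * ‖((η : ℂ))⁻¹‖ ^ 2 * d * ρ) ≤ μ / 2 := by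
    have : μ * CS * (ε + ρ' + δQ) + (6 * ‖((η : ℂ))⁻¹‖ ^ 2 * d * KR * (ε + ρ' + δQ) + 16 * ‖((η : ℂ))⁻¹‖ ^ 2 * d * CS * (ε + ρ' + δQ)) = B * (ε + ρ' + δQ) := by
      rw [hBdef]; ring
    linarith [hμρ, hεΔ, hMρ]
  have hrew : μ * (1 - ρ) - (2 * (2 + εR) * ‖((η : ℂ))⁻¹‖ ^ 2 * d * εR + 4 * (1 + εR) ^ 2 * ‖((η : ℂ))⁻¹‖ ^ 2 * d * ρ) =
      μ - (μ * ρ + (2 * (2 + εR) * ‖((η : ℂ))⁻¹‖ ^ 2 * d * εR + 4 * (1 + εR) ^ 2 * ‖((η : ℂ))⁻¹‖ ^ 2 * d * ρ)) := by ring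
  have hν2 : μ / 2 ≤ μ * (1 - ρ) - (2 * (2 + εR) * ‖((η : ℂ))⁻¹‖ ^ 2 * d * εR + 4 * (1 + εR) ^ 2 * ‖((η : ℂ))⁻¹‖ ^ 2 * d * ρ) := by
    rw [hrew]; linarith
  have hν : 0 < μ * (1 - ρ) - (2 * (2 + εR) * ‖((η : ℂ))⁻¹‖ ^ 2 * d * εR + 4 * (1 + εR) ^ 2 * ‖((η : ℂ))⁻¹‖ ^ 2 * d * ρ) :=
    lt_of_lt_of_le (by positivity) hν2
  -- the `R`-remainder: `δR ≤ 4(εΔ + Mρ)/μ ≤ 4(6nc²dK_R + 16nc²dC_S)t/μ`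
  have hδR : 2 * (2 * (2 + εR) * ‖((η : ℂ))⁻¹‖ ^ 2 * d * εR + 4 * (1 + εR) ^ 2 * ‖((η : ℂ))⁻¹‖ ^ 2 * d * ρ) /
      (μ * (1 - ρ) - (2 * (2 + εR) * ‖((η : ℂ))⁻¹‖ ^ 2 * d * εR + 4 * (1 + εR) ^ 2 * ‖((η : ℂ))⁻¹‖ ^ 2 * d * ρ)) ≤
      4 * (6 * ‖((η : ℂ))⁻¹‖ ^ 2 * d * KR + 16 * ‖((η : ℂ))⁻¹‖ ^ 2 * d * CS) * (ε + ρ' + δQ) / μ := by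
    have hnum : 0 ≤ 2 * (2 * (2 + εR) * ‖((η : ℂ))⁻¹‖ ^ 2 * d * εR + 4 * (1 + εR) ^ 2 * ‖((η : ℂ))⁻¹‖ ^ 2 * d * ρ) := by positivity
    calc _ ≤ 2 * (2 * (2 + εR) * ‖((η : ℂ))⁻¹‖ ^ 2 * d * εR + 4 * (1 + εR) ^ 2 * ‖((η : ℂ))⁻¹‖ ^ 2 * d * ρ) / (μ / 2) :=
          div_le_div_of_nonneg_left hnum (by positivity) hν2
      _ = 4 * (2 * (2 + εR) * ‖((η : ℂ))⁻¹‖ ^ 2 * d * εR + 4 * (1 + εR) ^ 2 * ‖((η : ℂ))⁻¹‖ ^ 2 * d * ρ) / μ := by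
          field_simp; ring
      _ ≤ 4 * (6 * ‖((η : ℂ))⁻¹‖ ^ 2 * d * KR * (ε + ρ' + δQ) + 16 * ‖((η : ℂ))⁻¹‖ ^ 2 * d * CS * (ε + ρ' + δQ)) / μ := by
          gcongr
      _ = 4 * (6 * ‖((η : ℂ))⁻¹‖ ^ 2 * d * KR + 16 * ‖((η : ℂ))⁻¹‖ ^ 2 * d * CS) * (ε + ρ' + δQ) / μ := by ring
  -- the four pieces of the remainder constant against `K·t`
  have hP' : 16 * d * (2 + εR) * ‖((η : ℂ))⁻¹‖ ^ 2 * εR ≤ 48 * d * ‖((η : ℂ))⁻¹‖ ^ 2 * KR * (ε + ρ' + δQ) := by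
    have h1 : 2 + εR ≤ 3 := by linarith
    calc 16 * d * (2 + εR) * ‖((η : ℂ))⁻¹‖ ^ 2 * εR = (16 * d * ‖((η : ℂ))⁻¹‖ ^ 2) * ((2 + εR) * εR) := by ring
      _ ≤ (16 * d * ‖((η : ℂ))⁻¹‖ ^ 2) * (3 * (KR * (ε + ρ' + δQ))) :=
          mul_le_mul_of_nonneg_left (mul_le_mul h1 hεRt hεR (by norm_num)) (by positivity)
      _ = 48 * d * ‖((η : ℂ))⁻¹‖ ^ 2 * KR * (ε + ρ' + δQ) := by ring
  have hD' : 2 * (2 * (1 + εR) * ‖((η : ℂ))⁻¹‖ * Real.sqrt d) * (‖((η : ℂ))⁻¹‖ * εR * Real.sqrt d) ≤ 8 * ‖((η : ℂ))⁻¹‖ ^ 2 * d * KR * (ε + ρ' + δQ) := by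
    have h1 : 1 + εR ≤ 2 := by linarith
    calc 2 * (2 * (1 + εR) * ‖((η : ℂ))⁻¹‖ * Real.sqrt d) * (‖((η : ℂ))⁻¹‖ * εR * Real.sqrt d) = 4 * ‖((η : ℂ))⁻¹‖ ^ 2 * (Real.sqrt d * Real.sqrt d) * ((1 + εR) * εR) := by ring
      _ = 4 * ‖((η : ℂ))⁻¹‖ ^ 2 * d * ((1 + εR) * εR) := by rw [hsd]
      _ ≤ 4 * ‖((η : ℂ))⁻¹‖ ^ 2 * d * (2 * (KR * (ε + ρ' + δQ))) :=
          mul_le_mul_of_nonneg_left (mul_le_mul h1 hεRt hεR (by norm_num)) (by positivity)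
      _ = 8 * ‖((η : ℂ))⁻¹‖ ^ 2 * d * KR * (ε + ρ' + δQ) := by ring
  have hR' : (2 * (1 + εR) * ‖((η : ℂ))⁻¹‖ * Real.sqrt d) ^ 2 *
      (2 * (2 * (2 + εR) * ‖((η : ℂ))⁻¹‖ ^ 2 * d * εR + 4 * (1 + εR) ^ 2 * ‖((η : ℂ))⁻¹‖ ^ 2 * d * ρ) /
        (μ * (1 - ρ) - (2 * (2 + εR) * ‖((η : ℂ))⁻¹‖ ^ 2 * d * εR + 4 * (1 + εR) ^ 2 * ‖((η : ℂ))⁻¹‖ ^ 2 * d * ρ))) ≤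
      64 * ‖((η : ℂ))⁻¹‖ ^ 2 * d * (6 * ‖((η : ℂ))⁻¹‖ ^ 2 * d * KR + 16 * ‖((η : ℂ))⁻¹‖ ^ 2 * d * CS) / μ * (ε + ρ' + δQ) := by
    have hsq : (2 * (1 + εR) * ‖((η : ℂ))⁻¹‖ * Real.sqrt d) ^ 2 = 4 * (1 + εR) ^ 2 * ‖((η : ℂ))⁻¹‖ ^ 2 * d := by
      rw [show (2 * (1 + εR) * ‖((η : ℂ))⁻¹‖ * Real.sqrt d) ^ 2 = 4 * (1 + εR) ^ 2 * ‖((η : ℂ))⁻¹‖ ^ 2 * (Real.sqrt d * Real.sqrt d) by ring, hsd]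
    rw [hsq]
    have hδR0 : 0 ≤ 2 * (2 * (2 + εR) * ‖((η : ℂ))⁻¹‖ ^ 2 * d * εR + 4 * (1 + εR) ^ 2 * ‖((η : ℂ))⁻¹‖ ^ 2 * d * ρ) /
        (μ * (1 - ρ) - (2 * (2 + εR) * ‖((η : ℂ))⁻¹‖ ^ 2 * d * εR + 4 * (1 + εR) ^ 2 * ‖((η : ℂ))⁻¹‖ ^ 2 * d * ρ)) := div_nonneg (by positivity) hν.le
    calc 4 * (1 + εR) ^ 2 * ‖((η : ℂ))⁻¹‖ ^ 2 * d * (2 * (2 * (2 + εR) * ‖((η : ℂ))⁻¹‖ ^ 2 * d * εR + 4 * (1 + εR) ^ 2 * ‖((η : ℂ))⁻¹‖ ^ 2 * d * ρ) /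
          (μ * (1 - ρ) - (2 * (2 + εR) * ‖((η : ℂ))⁻¹‖ ^ 2 * d * εR + 4 * (1 + εR) ^ 2 * ‖((η : ℂ))⁻¹‖ ^ 2 * d * ρ)))
        ≤ 16 * ‖((η : ℂ))⁻¹‖ ^ 2 * d * (4 * (6 * ‖((η : ℂ))⁻¹‖ ^ 2 * d * KR + 16 * ‖((η : ℂ))⁻¹‖ ^ 2 * d * CS) * (ε + ρ' + δQ) / μ) :=
          mul_le_mul hM16 hδR hδR0 (by positivity)
      _ = 64 * ‖((η : ℂ))⁻¹‖ ^ 2 * d * (6 * ‖((η : ℂ))⁻¹‖ ^ 2 * d * KR + 16 * ‖((η : ℂ))⁻¹‖ ^ 2 * d * CS) / μ * (ε + ρ' + δQ) := by ring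
  have hQ'' : |a| * δQ * (2 * MQ + δQ) ≤ |a| * (2 * MQ + 1) * (ε + ρ' + δQ) := by
    have h1 : 2 * MQ + δQ ≤ 2 * MQ + 1 := by linarith
    calc |a| * δQ * (2 * MQ + δQ) = |a| * (δQ * (2 * MQ + δQ)) := by ring
      _ ≤ |a| * ((ε + ρ' + δQ) * (2 * MQ + 1)) :=
          mul_le_mul_of_nonneg_left (mul_le_mul hδQt h1 (by positivity) (by positivity)) (abs_nonneg a)
      _ = |a| * (2 * MQ + 1) * (ε + ρ' + δQ) := by ring
  have hKt : K * (ε + ρ' + δQ) ≤ γ₀ / 2 := mul_le_half_of_le_div hK hγ₀.le ht3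
  have hδ : 16 * d * (2 + εR) * ‖((η : ℂ))⁻¹‖ ^ 2 * εR
      + 2 * (2 * (1 + εR) * ‖((η : ℂ))⁻¹‖ * Real.sqrt d) * (‖((η : ℂ))⁻¹‖ * εR * Real.sqrt d)
      + (2 * (1 + εR) * ‖((η : ℂ))⁻¹‖ * Real.sqrt d) ^ 2 *
        (2 * (2 * (2 + εR) * ‖((η : ℂ))⁻¹‖ ^ 2 * d * εR + 4 * (1 + εR) ^ 2 * ‖((η : ℂ))⁻¹‖ ^ 2 * d * ρ) /
          (μ * (1 - ρ) - (2 * (2 + εR) * ‖((η : ℂ))⁻¹‖ ^ 2 * d * εR + 4 * (1 + εR) ^ 2 * ‖((η : ℂ))⁻¹‖ ^ 2 * d * ρ)))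
      + |a| * δQ * (2 * MQ + δQ) ≤ γ₀ / 2 := by
    have hKsum : 48 * d * ‖((η : ℂ))⁻¹‖ ^ 2 * KR * (ε + ρ' + δQ) + 8 * ‖((η : ℂ))⁻¹‖ ^ 2 * d * KR * (ε + ρ' + δQ)
        + 64 * ‖((η : ℂ))⁻¹‖ ^ 2 * d * (6 * ‖((η : ℂ))⁻¹‖ ^ 2 * d * KR + 16 * ‖((η : ℂ))⁻¹‖ ^ 2 * d * CS) / μ * (ε + ρ' + δQ) + |a| * (2 * MQ + 1) * (ε + ρ' + δQ)
        = K * (ε + ρ' + δQ) := by rw [hKdef]; ring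
    calc _ ≤ 48 * d * ‖((η : ℂ))⁻¹‖ ^ 2 * KR * (ε + ρ' + δQ) + 8 * ‖((η : ℂ))⁻¹‖ ^ 2 * d * KR * (ε + ρ' + δQ)
        + 64 * ‖((η : ℂ))⁻¹‖ ^ 2 * d * (6 * ‖((η : ℂ))⁻¹‖ ^ 2 * d * KR + 16 * ‖((η : ℂ))⁻¹‖ ^ 2 * d * CS) / μ * (ε + ρ' + δQ)
        + |a| * (2 * MQ + 1) * (ε + ρ' + δQ) := add_le_add (add_le_add (add_le_add hP' hD') hR') hQ''
      _ = K * (ε + ρ' + δQ) := hKsum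
      _ ≤ γ₀ / 2 := hKt
  -- conclusion: `γ₀ − γ₀/2 = γ₀/2`
  have h := coercive_principal_of_near_flat_uniform L m hL φ hη ha (γ₀ / 2) U hα1 hU1 hreg (fun y =>
    (norm_principalGF_sub_flat_le L m hL φ η a U hα1 hU1 hreg hεR hρ0 hδQ hMQ hμ hR hRS hmod hρ hQ hQ₁ hν y).trans
      (mul_le_mul_of_nonneg_right hδ (norm_nonneg _))) x
  rw [← hγ₀def] at h
  have h2 : γ₀ / 2 = γ₀ - γ₀ / 2 := by ring
  rw [h2]
  exact h

end Uniform

end Literature.MathematicalPhysics.QuantumFieldTheory.Balaban1983to89.B9Thm311SmallFieldCoercivityUniform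

end
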